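import Literature.AlgebraicGeometry.PlaneCurves.HessePencilTriangles
import HarnessLib

/-!
# The nine harmonic polars of the Hesse pencil and the dual Hesse pencil (Artebani–Dolgachev §3)

Topic `Literature/AlgebraicGeometry/PlaneCurves`, namespace `Literature.AlgebraicGeometry.PlaneCurves`.
Lane `lit-hodgefound`, seat `lit-hodgefound-p37`, row g18-#3; a one-file sequel of
`HessePencilHessian` (g17-#8: the polar of the ONE base point `p₀ = (0, 1, −1)` splits as the
harmonic polar `Y − Z` times the inflection tangent; `hesse_eval`, `hesse_eval_pderiv`) and
`HessePencilTriangles` (g17-#10: the nine base points `c·(0, 1, −ω^k)`, `c·(1, 0, −ω^k)`,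
`c·(1, −ω^k, 0)` and `hesse_basePoint_cases`).  Everything here is PROVED (polynomial identities
in `K[X, Y, Z]` and their evaluations); no definition, no named fact.

Source followed — M. Artebani, I. Dolgachev, *The Hesse pencil of plane cubic curves*,
L'Enseignement Math. (2) 55 (2009) 235–273 [arXiv:math/0611590, held `paper:arxiv-math_0611590`
p0006 L9–L14], §3, and §4 [p0008 L60–L66]:

> Let `p_i = (a, b, c)` be one of the base points of the Hesse pencil. By computing the polar
> `P_{p_i}(E_λ)` we find that it is equal to the union of the inflection tangent line
> `𝕋_{p_i}(E_λ)` to the curve at the point `p_i` and the line `L_i : ax + by + cz = 0`. The lines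
> `L₀, …, L₈` are called the harmonic polars. It follows easily from the known properties of the
> first polars (which can be checked directly in our case) that the line `L_i` intersects the
> curve `E_λ` at 3 points `q_j` such that the tangent to the curve at `q_j` contains `p_i`. […]
> The harmonic polars, considered as points in the dual plane `ℙ̌²`, give the set of base points
> of a Hesse pencil in `ℙ̌²`. […] If we identify the plane with its dual by means of the quadratic
> form `x² + y² + z²`, the equation of the dual Hesse pencil coincides with the equation of the
> original pencil. For any nonsingular member of the Hesse pencil its nine tangents at the
> inflection points, considered as points in the dual plane, determine uniquely a member of the
> dual Hesse pencil.
> (§4) `Φ₉ = (x³ − y³)(x³ − z³)(y³ − z³)` […] Note that the curve `Φ₉ = 0` is the union of the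
> nine harmonic polars `L_i`.

## Dictionary

* The pencil member `E_λ = x³ + y³ + z³ + λxyz` at `λ = −3μ` is written
  `H_μ = X³ + Y³ + Z³ − 3μXYZ` (local notation `𝐇[μ]`, no definition), as in the two predecessor
  files; a cube root of unity is a `w ∈ K` with `w³ = 1` (the source's `ε^k`; with
  `ω² + ω + 1 = 0` these are `1, ω, ω²`, `HessePencilTriangles.pow_three_eq_one_iff_of_omega`), so
  that the nine base points are the `c·(0, 1, −w)`, `c·(1, 0, −w)`, `c·(1, −w, 0)`.
* The first polar of `F` with respect to `q` is `P_q(F) = Σ qᵢ ∂F/∂Xᵢ`; its value at a point `x`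
  is `⟨∇F(x), q⟩`, so "the tangent to the curve at `x` contains `q`" is `P_q(F)(x) = 0`.
* A line `αX + βY + γZ = 0` "considered as a point in the dual plane" is its coefficient vector
  `(α, β, γ)`; the dual Hesse pencil is `α³ + β³ + γ³ − 3ναβγ` in these coordinates.

## What is here

* §1 **`P_{p}(H_μ) = 𝕋_p(H_μ) ∪ L`** for ALL NINE base points, as identities in `K[X, Y, Z]` over
  any field (`w³ = 1`): `hesse_polar_basePoint₀/₁/₂` —
  `∂_Y H_μ − w ∂_Z H_μ = 3 (Y − w²Z)(μwX + Y + w²Z)` (base point `(0, 1, −w)`),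
  `∂_X H_μ − w ∂_Z H_μ = 3 (X − w²Z)(X + μwY + w²Z)` (base point `(1, 0, −w)`),
  `∂_X H_μ − w ∂_Y H_μ = 3 (X − w²Y)(X + w²Y + μwZ)` (base point `(1, −w, 0)`); and
  `hesse_grad_basePoint₀/₁/₂` — the base point lies on `H_μ` and `∇H_μ` there is
  `3c²·(μw, 1, w²)` (resp. `3c²·(1, μw, w²)`, `3c²·(1, w², μw)`), so the second factor IS the
  inflection tangent `𝕋_p(H_μ)` and the first is the harmonic polar `L`.
  SCOPE REMARK (recorded, not a claim against the source): for `p = (0, 1, −ε)` the harmonic polar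
  comes out as `y − ε²z = 0`, the line dual to the base point `(0, 1, −ε²)` — the printed
  `L_i : ax + by + cz = 0` for `p_i = (a, b, c)` is exact for the three real base points
  `p₀, p₃, p₆` and holds for all nine after `ε ↔ ε²` in the coefficients (the identification of
  the plane with its dual that makes `p_i ↦ L_i` is the Hermitian one); as a SET the nine harmonic
  polars are the nine lines `ax + by + cz = 0`, `(a, b, c)` a base point, exactly as printed
  (`hesse_polar_of_basePoint`).
* §2 **"the line `L_i` intersects the curve `E_λ` at 3 points `q_j` such that the tangent to the
  curve at `q_j` contains `p_i`"** for all nine: `hesse_polar_basePoint₀_eval` (& `₁`, `₂`) —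
  `⟨∇H_μ(q), p⟩ = 3 L(q) 𝕋_p(q)`, hence (`hesse_tangent_through_basePoint₀/₁/₂`) the tangent at
  every point of the harmonic polar passes through the base point, and conversely
  (`3 ≠ 0`) a point whose tangent contains `p` lies on `L` or on the inflection tangent.
* §3 **"The harmonic polars, considered as points in the dual plane, give the set of base points
  of a Hesse pencil in `ℙ̌²`"**: `hesse_polar_of_basePoint` — for EVERY base point `p` (a non-zero
  common zero of `XYZ` and `X³ + Y³ + Z³`, over a field with `ω² + ω + 1 = 0`) there are a base
  point `p'` and `c ≠ 0` with `P_p(H_μ) = c · ℓ_{p'} · 𝕋_p(H_μ)`, where `ℓ_{p'} = Σ p'ᵢ Xᵢ` is the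
  line dual to `p'` and `𝕋_p(H_μ) = Σ ∂ᵢH_μ(p) Xᵢ` the tangent at `p`; `hesse_harmonicPolars_dual`
  — the nine coefficient vectors `(0, 1, −w²)`, `(1, 0, −w²)`, `(1, −w², 0)` are common zeros of
  `αβγ` and `α³ + β³ + γ³`, i.e. base points of the dual pencil ("the equation of the dual Hesse
  pencil coincides with the equation of the original pencil").
* §4 **`Φ₉ = 0` is the union of the nine harmonic polars**: `phi₉_eq_prod_harmonicPolars` —
  `(X³ − Y³)(X³ − Z³)(Y³ − Z³) = ∏_{w³=1}(X − wY) · ∏(X − wZ) · ∏(Y − wZ)` in `K[X, Y, Z]`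
  (`ω² + ω + 1 = 0`).
* §5 **"its nine tangents at the inflection points, considered as points in the dual plane,
  determine uniquely a member of the dual Hesse pencil"**: `hesse_eval_dual_inflectionTangent` —
  the nine tangents `(μw, 1, w²)`, `(1, μw, w²)`, `(1, w², μw)` of `H_μ` all give the value
  `μ³ + 2 − 3νμ` on the dual member `α³ + β³ + γ³ − 3ναβγ`; so for `μ ≠ 0` (`3 ≠ 0`) they lie on
  the dual member with `ν = (μ³ + 2)/(3μ)` and on no other (`hesse_dual_inflectionTangent_iff`),
  while for the Fermat cubic `μ = 0` they lie on the triangle `αβγ = 0` of the dual pencil and on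
  no `α³ + β³ + γ³ − 3ναβγ` (`hesse_dual_inflectionTangent_fermat`, `2 ≠ 0`).  In the source's
  parameter `λ = −3μ` the dual member is `λ' = −3ν = (54 − λ³)/(9λ)`
  (`hesse_dual_inflectionTangent_parameter`) — the value `𝔠(λ)` of the source's formula (cay)
  for the Cayleyan curve (Prop. 3.3, consistent with "the Cayleyan curve parametrizes the line
  components of reducible polar conics": the inflection tangents are such components by §1);
  Prop. 3.3 itself is NOT claimed here.

NOT here: Prop. 3.2 (the sibling file `HessePencilHessianPreimages`, g18-#1), "together with `p_i` they form the group of `2`-torsion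
points" (the Weierstrass-model statement is `PlaneCubicTangentsThroughFlex.
weierstrass_tangent_through_e₁_iff_two_nsmul_eq_zero`), "its inflection lines are the lines dual
to the vertices of the inflection triangles", the Cayleyan curve (Prop. 3.3), Remark 3.1 (line
arrangements).

## References
* [ArtebaniDolgachev2009] M. Artebani, I. Dolgachev, *The Hesse pencil of plane cubic curves*,
  Enseign. Math. (2) 55 (2009) 235–273, §3 (the harmonic polars, the dual Hesse pencil), §4
  (`Φ₉`).
* [Kunz2005PlaneAlgebraicCurves] E. Kunz, *Introduction to Plane Algebraic Curves*, Birkhäuser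
  2005, Ch. 9, Def. 9.1 (the polar `D_P F = Σ pᵢ ∂F/∂Xᵢ`), Thm. 9.2 (b) (tangents through `P`).
-/

set_option autoImplicit false

open MvPolynomial Matrix

namespace Literature.AlgebraicGeometry.PlaneCurves

universe u

/-- The Hesse cubic `H_μ = X³ + Y³ + Z³ − 3μXYZ` (local notation as in the statements of
`HessePencilWeierstrassForm`, no definition). -/
local notation3 "𝐇[" μ "]" =>
  (X 0 ^ 3 + X 1 ^ 3 + X 2 ^ 3 - C (3 * μ) * (X 0 * X 1 * X 2) : MvPolynomial (Fin 3) _)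

section HarmonicPolars

variable {K : Type u} [Field K]

/-- Derivations kill numerals (`no_index` so that `simp` matches literals). [folklore] -/
private theorem pderiv_ofNat_hp (i : Fin 3) (n : ℕ) [n.AtLeastTwo] :
    pderiv i (no_index (OfNat.ofNat n : MvPolynomial (Fin 3) K)) = 0 := by
  rw [← map_ofNat (C : K →+* MvPolynomial (Fin 3) K) n, pderiv_C]

/-- The partial derivatives of `H_μ`. [folklore] -/
private theorem pderiv_hesse_hp (μ : K) :
    (pderiv 0 𝐇[μ] = C 3 * X 0 ^ 2 - C (3 * μ) * (X 1 * X 2)) ∧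
    (pderiv 1 𝐇[μ] = C 3 * X 1 ^ 2 - C (3 * μ) * (X 0 * X 2)) ∧
    (pderiv 2 𝐇[μ] = C 3 * X 2 ^ 2 - C (3 * μ) * (X 0 * X 1)) := by
  refine ⟨?_, ?_, ?_⟩ <;> simp [pderiv_X, pderiv_ofNat_hp, map_ofNat, mul_comm]

/-- `C w ^ 3 = 1` in `K[X, Y, Z]` for a cube root of unity `w`. [folklore] -/
private theorem C_pow_three_eq_one {w : K} (hw : w ^ 3 = 1) :
    (C w : MvPolynomial (Fin 3) K) ^ 3 = 1 := by
  rw [← C_pow, hw, C_1]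

/-! ## §1 The polar of a base point: inflection tangent times harmonic polar (all nine) -/

/-- **`P_p(H_μ) = 3 · L · 𝕋_p`** for the base points `p = (0, 1, −w)`, `w³ = 1` (any field):
`∂_Y H_μ − w ∂_Z H_μ = 3 (Y − w²Z)(μwX + Y + w²Z)` — the harmonic polar `Y − w²Z = 0` (the line
dual to the base point `(0, 1, −w²)`) times the inflection tangent `μwX + Y + w²Z = 0` at `p`
(`hesse_grad_basePoint₀`).  For `w = 1` this is `HessePencilHessian.hesse_polar_basePoint`.
[cite: ArtebaniDolgachev2009, §3 (the polar `P_{p_i}(E_λ)` is the union of `𝕋_{p_i}(E_λ)` and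
`L_i`)] -/
theorem hesse_polar_basePoint₀ (μ : K) {w : K} (hw : w ^ 3 = 1) :
    pderiv 1 𝐇[μ] - C w * pderiv 2 𝐇[μ] =
      C 3 * (X 1 - C w ^ 2 * X 2) * (C μ * C w * X 0 + X 1 + C w ^ 2 * X 2) := by
  obtain ⟨-, d1, d2⟩ := pderiv_hesse_hp μ
  rw [d1, d2, map_mul]
  linear_combination (C 3 * C μ * X 0 * X 2 + C 3 * C w * X 2 ^ 2 : MvPolynomial (Fin 3) K) *
    C_pow_three_eq_one hw

/-- **`P_p(H_μ) = 3 · L · 𝕋_p`** for the base points `p = (1, 0, −w)`, `w³ = 1`: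
`∂_X H_μ − w ∂_Z H_μ = 3 (X − w²Z)(X + μwY + w²Z)` — the harmonic polar `X − w²Z = 0` (dual to the
base point `(1, 0, −w²)`) times the inflection tangent at `p` (`hesse_grad_basePoint₁`).
[cite: ArtebaniDolgachev2009, §3 (the polar `P_{p_i}(E_λ)`, the harmonic polars)] -/
theorem hesse_polar_basePoint₁ (μ : K) {w : K} (hw : w ^ 3 = 1) :
    pderiv 0 𝐇[μ] - C w * pderiv 2 𝐇[μ] =
      C 3 * (X 0 - C w ^ 2 * X 2) * (X 0 + C μ * C w * X 1 + C w ^ 2 * X 2) := by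
  obtain ⟨d0, -, d2⟩ := pderiv_hesse_hp μ
  rw [d0, d2, map_mul]
  linear_combination (C 3 * C μ * X 1 * X 2 + C 3 * C w * X 2 ^ 2 : MvPolynomial (Fin 3) K) *
    C_pow_three_eq_one hw

/-- **`P_p(H_μ) = 3 · L · 𝕋_p`** for the base points `p = (1, −w, 0)`, `w³ = 1`:
`∂_X H_μ − w ∂_Y H_μ = 3 (X − w²Y)(X + w²Y + μwZ)` — the harmonic polar `X − w²Y = 0` (dual to the
base point `(1, −w², 0)`) times the inflection tangent at `p` (`hesse_grad_basePoint₂`).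
[cite: ArtebaniDolgachev2009, §3 (the polar `P_{p_i}(E_λ)`, the harmonic polars)] -/
theorem hesse_polar_basePoint₂ (μ : K) {w : K} (hw : w ^ 3 = 1) :
    pderiv 0 𝐇[μ] - C w * pderiv 1 𝐇[μ] =
      C 3 * (X 0 - C w ^ 2 * X 1) * (X 0 + C w ^ 2 * X 1 + C μ * C w * X 2) := by
  obtain ⟨d0, d1, -⟩ := pderiv_hesse_hp μ
  rw [d0, d1, map_mul]
  linear_combination (C 3 * C μ * X 1 * X 2 + C 3 * C w * X 1 ^ 2 : MvPolynomial (Fin 3) K) *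
    C_pow_three_eq_one hw

/-- The base point `c·(0, 1, −w)` (`w³ = 1`) lies on every `H_μ`, and `∇H_μ` there is
`3c²·(μw, 1, w²)`: its tangent line is `μwX + Y + w²Z = 0`, the second factor of
`hesse_polar_basePoint₀`. [cite: ArtebaniDolgachev2009, §3 (the inflection tangent
`𝕋_{p_i}(E_λ)`)] -/
theorem hesse_grad_basePoint₀ (μ : K) {w : K} (hw : w ^ 3 = 1) (c : K) :
    eval (c • ![0, 1, -w]) 𝐇[μ] = 0 ∧
      (fun i => eval (c • ![0, 1, -w]) (pderiv i 𝐇[μ])) = (3 * c ^ 2) • ![μ * w, 1, w ^ 2] := by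
  rw [hesse_eval, hesse_eval_pderiv]
  constructor
  · simp
    linear_combination (-(c ^ 3)) * hw
  · funext i
    fin_cases i <;> simp <;> ring

/-- The base point `c·(1, 0, −w)` (`w³ = 1`) lies on every `H_μ`, with
`∇H_μ = 3c²·(1, μw, w²)` there: tangent line `X + μwY + w²Z = 0`.
[cite: ArtebaniDolgachev2009, §3 (the inflection tangent `𝕋_{p_i}(E_λ)`)] -/
theorem hesse_grad_basePoint₁ (μ : K) {w : K} (hw : w ^ 3 = 1) (c : K) :
    eval (c • ![1, 0, -w]) 𝐇[μ] = 0 ∧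
      (fun i => eval (c • ![1, 0, -w]) (pderiv i 𝐇[μ])) = (3 * c ^ 2) • ![1, μ * w, w ^ 2] := by
  rw [hesse_eval, hesse_eval_pderiv]
  constructor
  · simp
    linear_combination (-(c ^ 3)) * hw
  · funext i
    fin_cases i <;> simp <;> ring

/-- The base point `c·(1, −w, 0)` (`w³ = 1`) lies on every `H_μ`, with
`∇H_μ = 3c²·(1, w², μw)` there: tangent line `X + w²Y + μwZ = 0`.
[cite: ArtebaniDolgachev2009, §3 (the inflection tangent `𝕋_{p_i}(E_λ)`)] -/
theorem hesse_grad_basePoint₂ (μ : K) {w : K} (hw : w ^ 3 = 1) (c : K) :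
    eval (c • ![1, -w, 0]) 𝐇[μ] = 0 ∧
      (fun i => eval (c • ![1, -w, 0]) (pderiv i 𝐇[μ])) = (3 * c ^ 2) • ![1, w ^ 2, μ * w] := by
  rw [hesse_eval, hesse_eval_pderiv]
  constructor
  · simp
    linear_combination (-(c ^ 3)) * hw
  · funext i
    fin_cases i <;> simp <;> ring

/-! ## §2 The tangents at the points of a harmonic polar pass through the base point -/

/-- The polar identity of `hesse_polar_basePoint₀` evaluated at a point `q`:
`⟨∇H_μ(q), (0, 1, −w)⟩ = 3 (q₁ − w²q₂)(μwq₀ + q₁ + w²q₂)` (`w³ = 1`).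
[cite: ArtebaniDolgachev2009, §3 ("which can be checked directly in our case")] -/
theorem hesse_polar_basePoint₀_eval (μ : K) {w : K} (hw : w ^ 3 = 1) (q : Fin 3 → K) :
    (fun i => eval q (pderiv i 𝐇[μ])) ⬝ᵥ ![0, 1, -w] =
      3 * (q 1 - w ^ 2 * q 2) * (μ * w * q 0 + q 1 + w ^ 2 * q 2) := by
  rw [hesse_eval_pderiv]
  simp [dotProduct, Fin.sum_univ_three]
  linear_combination (3 * μ * q 0 * q 2 + 3 * w * q 2 ^ 2) * hw

/-- The polar identity of `hesse_polar_basePoint₁` evaluated at `q`: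
`⟨∇H_μ(q), (1, 0, −w)⟩ = 3 (q₀ − w²q₂)(q₀ + μwq₁ + w²q₂)`.
[cite: ArtebaniDolgachev2009, §3 ("which can be checked directly in our case")] -/
theorem hesse_polar_basePoint₁_eval (μ : K) {w : K} (hw : w ^ 3 = 1) (q : Fin 3 → K) :
    (fun i => eval q (pderiv i 𝐇[μ])) ⬝ᵥ ![1, 0, -w] =
      3 * (q 0 - w ^ 2 * q 2) * (q 0 + μ * w * q 1 + w ^ 2 * q 2) := by
  rw [hesse_eval_pderiv]
  simp [dotProduct, Fin.sum_univ_three]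
  linear_combination (3 * μ * q 1 * q 2 + 3 * w * q 2 ^ 2) * hw

/-- The polar identity of `hesse_polar_basePoint₂` evaluated at `q`:
`⟨∇H_μ(q), (1, −w, 0)⟩ = 3 (q₀ − w²q₁)(q₀ + w²q₁ + μwq₂)`.
[cite: ArtebaniDolgachev2009, §3 ("which can be checked directly in our case")] -/
theorem hesse_polar_basePoint₂_eval (μ : K) {w : K} (hw : w ^ 3 = 1) (q : Fin 3 → K) :
    (fun i => eval q (pderiv i 𝐇[μ])) ⬝ᵥ ![1, -w, 0] =
      3 * (q 0 - w ^ 2 * q 1) * (q 0 + w ^ 2 * q 1 + μ * w * q 2) := by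
  rw [hesse_eval_pderiv]
  simp [dotProduct, Fin.sum_univ_three]
  linear_combination (3 * μ * q 1 * q 2 + 3 * w * q 1 ^ 2) * hw

/-- **"the line `L_i` intersects the curve `E_λ` at 3 points `q_j` such that the tangent to the
curve at `q_j` contains `p_i`"**, base points `p = (0, 1, −w)`: at every point `q` of the
harmonic polar `Y = w²Z` (on the curve or not), `⟨∇H_μ(q), p⟩ = 0` — the tangent at `q` passes
through `p`; and conversely, when `3 ≠ 0`, a point whose tangent contains `p` lies on the
harmonic polar or on the inflection tangent `μwX + Y + w²Z = 0` at `p`.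
[cite: ArtebaniDolgachev2009, §3 (the points `q_j` of `L_i ∩ E_λ`)]
[cite: Kunz2005PlaneAlgebraicCurves, Ch. 9, Thm. 9.2 (b)] -/
theorem hesse_tangent_through_basePoint₀ (μ : K) {w : K} (hw : w ^ 3 = 1) (q : Fin 3 → K) :
    (q 1 = w ^ 2 * q 2 → (fun i => eval q (pderiv i 𝐇[μ])) ⬝ᵥ ![0, 1, -w] = 0) ∧
      ((3 : K) ≠ 0 → (fun i => eval q (pderiv i 𝐇[μ])) ⬝ᵥ ![0, 1, -w] = 0 →
        q 1 = w ^ 2 * q 2 ∨ μ * w * q 0 + q 1 + w ^ 2 * q 2 = 0) := by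
  rw [hesse_polar_basePoint₀_eval μ hw]
  refine ⟨fun h => by rw [h]; ring, fun h3 h => ?_⟩
  rcases mul_eq_zero.1 h with h' | h'
  · rcases mul_eq_zero.1 h' with h'' | h''
    · exact absurd h'' h3
    · exact Or.inl (by linear_combination h'')
  · exact Or.inr h'

/-- The same for the base points `p = (1, 0, −w)` and their harmonic polars `X = w²Z`.
[cite: ArtebaniDolgachev2009, §3 (the points `q_j` of `L_i ∩ E_λ`)]
[cite: Kunz2005PlaneAlgebraicCurves, Ch. 9, Thm. 9.2 (b)] -/
theorem hesse_tangent_through_basePoint₁ (μ : K) {w : K} (hw : w ^ 3 = 1) (q : Fin 3 → K) :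
    (q 0 = w ^ 2 * q 2 → (fun i => eval q (pderiv i 𝐇[μ])) ⬝ᵥ ![1, 0, -w] = 0) ∧
      ((3 : K) ≠ 0 → (fun i => eval q (pderiv i 𝐇[μ])) ⬝ᵥ ![1, 0, -w] = 0 →
        q 0 = w ^ 2 * q 2 ∨ q 0 + μ * w * q 1 + w ^ 2 * q 2 = 0) := by
  rw [hesse_polar_basePoint₁_eval μ hw]
  refine ⟨fun h => by rw [h]; ring, fun h3 h => ?_⟩
  rcases mul_eq_zero.1 h with h' | h'
  · rcases mul_eq_zero.1 h' with h'' | h''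
    · exact absurd h'' h3
    · exact Or.inl (by linear_combination h'')
  · exact Or.inr h'

/-- The same for the base points `p = (1, −w, 0)` and their harmonic polars `X = w²Y`.
[cite: ArtebaniDolgachev2009, §3 (the points `q_j` of `L_i ∩ E_λ`)]
[cite: Kunz2005PlaneAlgebraicCurves, Ch. 9, Thm. 9.2 (b)] -/
theorem hesse_tangent_through_basePoint₂ (μ : K) {w : K} (hw : w ^ 3 = 1) (q : Fin 3 → K) :
    (q 0 = w ^ 2 * q 1 → (fun i => eval q (pderiv i 𝐇[μ])) ⬝ᵥ ![1, -w, 0] = 0) ∧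
      ((3 : K) ≠ 0 → (fun i => eval q (pderiv i 𝐇[μ])) ⬝ᵥ ![1, -w, 0] = 0 →
        q 0 = w ^ 2 * q 1 ∨ q 0 + w ^ 2 * q 1 + μ * w * q 2 = 0) := by
  rw [hesse_polar_basePoint₂_eval μ hw]
  refine ⟨fun h => by rw [h]; ring, fun h3 h => ?_⟩
  rcases mul_eq_zero.1 h with h' | h'
  · rcases mul_eq_zero.1 h' with h'' | h''
    · exact absurd h'' h3
    · exact Or.inl (by linear_combination h'')
  · exact Or.inr h'

/-! ## §3 The harmonic polars as points of the dual plane: the base points of the dual pencil -/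

/-- **"The harmonic polars, considered as points in the dual plane `ℙ̌²`, give the set of base
points of a Hesse pencil in `ℙ̌²`"** — for EVERY base point `p` of the Hesse pencil (a non-zero
common zero of `XYZ` and `X³ + Y³ + Z³`, over a field containing `ω` with `ω² + ω + 1 = 0`) the
polar `P_p(H_μ) = Σ pᵢ ∂ᵢH_μ` is `c · ℓ_{p'} · 𝕋_p(H_μ)` with `c ≠ 0`, where
`𝕋_p(H_μ) = Σ ∂ᵢH_μ(p) Xᵢ` is the inflection tangent at `p` and `ℓ_{p'} = Σ p'ᵢ Xᵢ` is the line
DUAL TO ANOTHER BASE POINT `p'` (one of `(0, 1, −ω^k)`, `(1, 0, −ω^k)`, `(1, −ω^k, 0)`); thus the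
set of the nine harmonic polars, read in the dual plane, is the set of the nine base points.
[cite: ArtebaniDolgachev2009, §3 (the harmonic polars are the base points of the dual Hesse
pencil)] -/
theorem hesse_polar_of_basePoint (μ : K) {ω : K} (hω : ω ^ 2 + ω + 1 = 0) {p : Fin 3 → K}
    (hp0 : p ≠ 0) (hπ : p 0 * p 1 * p 2 = 0) (hS : p 0 ^ 3 + p 1 ^ 3 + p 2 ^ 3 = 0) :
    ∃ (c : K) (k : ℕ) (p' : Fin 3 → K), c ≠ 0 ∧
      (p' = ![0, 1, -ω ^ k] ∨ p' = ![1, 0, -ω ^ k] ∨ p' = ![1, -ω ^ k, 0]) ∧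
      ∑ i, C (p i) * pderiv i 𝐇[μ] =
        C c * (∑ i, C (p' i) * X i) * ∑ i, C (eval p (pderiv i 𝐇[μ])) * X i := by
  obtain ⟨c, k, hc, -, hp⟩ := hesse_basePoint_cases hω hp0 hπ hS
  have hk : (ω ^ k) ^ 3 = 1 := by
    rw [← pow_mul, mul_comm, pow_mul, omega_pow_three hω, one_pow]
  have h2k : (ω ^ k) ^ 2 = ω ^ (2 * k) := by rw [← pow_mul, mul_comm]
  obtain ⟨d0, d1, d2⟩ := pderiv_hesse_hp μ
  have hcinv : (C c : MvPolynomial (Fin 3) K) * C c⁻¹ = 1 := by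
    rw [← C_mul, mul_inv_cancel₀ hc, C_1]
  generalize hw : ω ^ k = w at hk h2k hp
  have hk' : (C w : MvPolynomial (Fin 3) K) ^ 3 = 1 := C_pow_three_eq_one hk
  rcases hp with rfl | rfl | rfl
  · refine ⟨c⁻¹, 2 * k, ![0, 1, -ω ^ (2 * k)], inv_ne_zero hc, Or.inl rfl, ?_⟩
    have hgi : ∀ i, eval (c • ![0, 1, -w]) (pderiv i 𝐇[μ]) =
        ((3 * c ^ 2) • ![μ * w, 1, w ^ 2] : Fin 3 → K) i :=
      fun i => congr_fun (hesse_grad_basePoint₀ μ hk c).2 i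
    rw [← h2k]
    simp only [Fin.sum_univ_three, hgi, Pi.smul_apply, smul_eq_mul, Matrix.cons_val_zero,
      Matrix.cons_val_one, Matrix.cons_val_two, Matrix.head_cons, Matrix.tail_cons, d0, d1, d2,
      mul_zero, mul_one, mul_neg]
    simp only [map_mul, map_neg, map_pow, map_one, map_zero, zero_mul, one_mul, zero_add, neg_mul]
    linear_combination (-(C 3 * C c * (X 1 - C w ^ 2 * X 2) *
        (C μ * C w * X 0 + X 1 + C w ^ 2 * X 2) : MvPolynomial (Fin 3) K)) * hcinv +
      (C c * (C 3 * C μ * X 0 * X 2 + C 3 * C w * X 2 ^ 2)) * hk'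
  · refine ⟨c⁻¹, 2 * k, ![1, 0, -ω ^ (2 * k)], inv_ne_zero hc, Or.inr (Or.inl rfl), ?_⟩
    have hgi : ∀ i, eval (c • ![1, 0, -w]) (pderiv i 𝐇[μ]) =
        ((3 * c ^ 2) • ![1, μ * w, w ^ 2] : Fin 3 → K) i :=
      fun i => congr_fun (hesse_grad_basePoint₁ μ hk c).2 i
    rw [← h2k]
    simp only [Fin.sum_univ_three, hgi, Pi.smul_apply, smul_eq_mul, Matrix.cons_val_zero,
      Matrix.cons_val_one, Matrix.cons_val_two, Matrix.head_cons, Matrix.tail_cons, d0, d1, d2,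
      mul_zero, mul_one, mul_neg]
    simp only [map_mul, map_neg, map_pow, map_one, map_zero, zero_mul, one_mul, add_zero,
      neg_mul]
    linear_combination (-(C 3 * C c * (X 0 - C w ^ 2 * X 2) *
        (X 0 + C μ * C w * X 1 + C w ^ 2 * X 2) : MvPolynomial (Fin 3) K)) * hcinv +
      (C c * (C 3 * C μ * X 1 * X 2 + C 3 * C w * X 2 ^ 2)) * hk'
  · refine ⟨c⁻¹, 2 * k, ![1, -ω ^ (2 * k), 0], inv_ne_zero hc, Or.inr (Or.inr rfl), ?_⟩
    have hgi : ∀ i, eval (c • ![1, -w, 0]) (pderiv i 𝐇[μ]) =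
        ((3 * c ^ 2) • ![1, w ^ 2, μ * w] : Fin 3 → K) i :=
      fun i => congr_fun (hesse_grad_basePoint₂ μ hk c).2 i
    rw [← h2k]
    simp only [Fin.sum_univ_three, hgi, Pi.smul_apply, smul_eq_mul, Matrix.cons_val_zero,
      Matrix.cons_val_one, Matrix.cons_val_two, Matrix.head_cons, Matrix.tail_cons, d0, d1, d2,
      mul_zero, mul_one, mul_neg]
    simp only [map_mul, map_neg, map_pow, map_one, map_zero, zero_mul, one_mul, add_zero,
      neg_mul]
    linear_combination (-(C 3 * C c * (X 0 - C w ^ 2 * X 1) *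
        (X 0 + C w ^ 2 * X 1 + C μ * C w * X 2) : MvPolynomial (Fin 3) K)) * hcinv +
      (C c * (C 3 * C μ * X 1 * X 2 + C 3 * C w * X 1 ^ 2)) * hk'

/-- **The nine harmonic polars are base points of the dual pencil** ("If we identify the plane with
its dual by means of the quadratic form `x² + y² + z²`, the equation of the dual Hesse pencil
coincides with the equation of the original pencil"): the coefficient vectors `(0, 1, −w²)`,
`(1, 0, −w²)`, `(1, −w², 0)` of the harmonic polars of §1 (`w³ = 1`) are common zeros of `αβγ` and
`α³ + β³ + γ³`, hence lie on every member `α³ + β³ + γ³ − 3ναβγ` of the dual Hesse pencil.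
[cite: ArtebaniDolgachev2009, §3 (the harmonic polars are the base points of the dual Hesse
pencil)] -/
theorem hesse_harmonicPolars_dual {w : K} (hw : w ^ 3 = 1) (ν : K) :
    ∀ l ∈ [![(0 : K), 1, -w ^ 2], ![1, 0, -w ^ 2], ![1, -w ^ 2, 0]],
      (l : Fin 3 → K) 0 * l 1 * l 2 = 0 ∧ l 0 ^ 3 + l 1 ^ 3 + l 2 ^ 3 = 0 ∧ eval l 𝐇[ν] = 0 := by
  have hk : (w ^ 2) ^ 3 = 1 := by rw [← pow_mul, mul_comm, pow_mul, hw, one_pow]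
  intro l hl
  simp only [List.mem_cons, List.not_mem_nil, or_false] at hl
  rcases hl with rfl | rfl | rfl
  · refine ⟨by simp, ?_, ?_⟩
    · simp; linear_combination (-1 : K) * hk
    · rw [hesse_eval]; simp; linear_combination (-1 : K) * hk
  · refine ⟨by simp, ?_, ?_⟩
    · simp; linear_combination (-1 : K) * hk
    · rw [hesse_eval]; simp; linear_combination (-1 : K) * hk
  · refine ⟨by simp, ?_, ?_⟩
    · simp; linear_combination (-1 : K) * hk
    · rw [hesse_eval]; simp; linear_combination (-1 : K) * hk

/-! ## §4 `Φ₉ = 0` is the union of the nine harmonic polars -/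

/-- **"the curve `Φ₉ = 0` is the union of the nine harmonic polars `L_i`"**:
`Φ₉ = (X³ − Y³)(X³ − Z³)(Y³ − Z³)` is the product of the nine harmonic polars
`X − wY`, `X − wZ`, `Y − wZ` (`w ∈ {1, ω, ω²}`), identically in `K[X, Y, Z]` for
`ω² + ω + 1 = 0`. [cite: ArtebaniDolgachev2009, §4 (the invariant `Φ₉`)] -/
theorem phi₉_eq_prod_harmonicPolars {ω : K} (hω : ω ^ 2 + ω + 1 = 0) :
    ((X 0 ^ 3 - X 1 ^ 3) * (X 0 ^ 3 - X 2 ^ 3) * (X 1 ^ 3 - X 2 ^ 3) : MvPolynomial (Fin 3) K) =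
      ((X 0 - X 1) * (X 0 - C ω * X 1) * (X 0 - C ω ^ 2 * X 1)) *
      ((X 0 - X 2) * (X 0 - C ω * X 2) * (X 0 - C ω ^ 2 * X 2)) *
      ((X 1 - X 2) * (X 1 - C ω * X 2) * (X 1 - C ω ^ 2 * X 2)) := by
  have hr : (C ω : MvPolynomial (Fin 3) K) ^ 2 + C ω + 1 = 0 := by
    rw [← C_pow, ← C_add, ← C_1, ← C_add, hω, C_0]
  have key : ∀ u v : MvPolynomial (Fin 3) K,
      u ^ 3 - v ^ 3 = (u - v) * (u - C ω * v) * (u - C ω ^ 2 * v) := by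
    intro u v
    linear_combination ((u - v) * (u * v - (C ω - 1) * v ^ 2)) * hr
  rw [key (X 0) (X 1), key (X 0) (X 2), key (X 1) (X 2)]

/-! ## §5 The nine inflection tangents determine a member of the dual pencil -/

/-- **The nine inflection tangents as points of the dual plane**: the tangents of `H_μ` at its
nine flexes are (`hesse_grad_basePoint₀/₁/₂`) the dual points `(μw, 1, w²)`, `(1, μw, w²)`,
`(1, w², μw)` (`w³ = 1`), and on the dual member `α³ + β³ + γ³ − 3ναβγ` each of them gives the
SAME value `μ³ + 2 − 3νμ`. [cite: ArtebaniDolgachev2009, §3 ("its nine tangents at the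
inflection points, considered as points in the dual plane, determine uniquely a member of the
dual Hesse pencil")] -/
theorem hesse_eval_dual_inflectionTangent (μ ν : K) {w : K} (hw : w ^ 3 = 1) :
    eval ![μ * w, 1, w ^ 2] 𝐇[ν] = μ ^ 3 + 2 - 3 * ν * μ ∧
      eval ![1, μ * w, w ^ 2] 𝐇[ν] = μ ^ 3 + 2 - 3 * ν * μ ∧
      eval ![1, w ^ 2, μ * w] 𝐇[ν] = μ ^ 3 + 2 - 3 * ν * μ := by
  rw [hesse_eval, hesse_eval, hesse_eval]
  refine ⟨?_, ?_, ?_⟩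
  · simp; linear_combination (μ ^ 3 + w ^ 3 + 1 - 3 * ν * μ) * hw
  · simp; linear_combination (μ ^ 3 + w ^ 3 + 1 - 3 * ν * μ) * hw
  · simp; linear_combination (μ ^ 3 + w ^ 3 + 1 - 3 * ν * μ) * hw

/-- **"determine uniquely a member of the dual Hesse pencil"**: for `μ ≠ 0` (and `3 ≠ 0`), an
inflection tangent of `H_μ` — any of the nine dual points `(μw, 1, w²)`, `(1, μw, w²)`,
`(1, w², μw)` — lies on the dual member `α³ + β³ + γ³ − 3ναβγ` if and only if
`ν = (μ³ + 2)/(3μ)`. [cite: ArtebaniDolgachev2009, §3 (the nine inflection tangents determine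
uniquely a member of the dual Hesse pencil)] -/
theorem hesse_dual_inflectionTangent_iff (h3 : (3 : K) ≠ 0) {μ : K} (hμ : μ ≠ 0) (ν : K) {w : K}
    (hw : w ^ 3 = 1) :
    ∀ t ∈ [![μ * w, 1, w ^ 2], ![1, μ * w, w ^ 2], ![1, w ^ 2, μ * w]],
      eval (t : Fin 3 → K) 𝐇[ν] = 0 ↔ ν = (μ ^ 3 + 2) / (3 * μ) := by
  obtain ⟨e0, e1, e2⟩ := hesse_eval_dual_inflectionTangent μ ν hw
  have key : μ ^ 3 + 2 - 3 * ν * μ = 0 ↔ ν = (μ ^ 3 + 2) / (3 * μ) := by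
    rw [eq_div_iff (mul_ne_zero h3 hμ)]
    constructor <;> intro h <;> linear_combination -h
  intro t ht
  simp only [List.mem_cons, List.not_mem_nil, or_false] at ht
  rcases ht with rfl | rfl | rfl
  · rw [e0, key]
  · rw [e1, key]
  · rw [e2, key]

/-- The Fermat cubic `μ = 0`: its nine inflection tangents `(0, 1, w²)`, `(1, 0, w²)`,
`(1, w², 0)` lie on the triangle `αβγ = 0` of the dual pencil, and (when `2 ≠ 0`) on no member
`α³ + β³ + γ³ − 3ναβγ` — so again on a unique member of the dual pencil
`t₀(α³ + β³ + γ³) + t₁αβγ`, the one with `t₀ = 0`. [cite: ArtebaniDolgachev2009, §3 (the nine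
inflection tangents determine uniquely a member of the dual Hesse pencil)] -/
theorem hesse_dual_inflectionTangent_fermat (h2 : (2 : K) ≠ 0) (ν : K) {w : K} (hw : w ^ 3 = 1) :
    ∀ t ∈ [![(0 : K) * w, 1, w ^ 2], ![1, 0 * w, w ^ 2], ![1, w ^ 2, 0 * w]],
      (t : Fin 3 → K) 0 * t 1 * t 2 = 0 ∧ eval t 𝐇[ν] ≠ 0 := by
  obtain ⟨e0, e1, e2⟩ := hesse_eval_dual_inflectionTangent (0 : K) ν hw
  have hv : (0 : K) ^ 3 + 2 - 3 * ν * 0 ≠ 0 := by simpa using h2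
  intro t ht
  simp only [List.mem_cons, List.not_mem_nil, or_false] at ht
  rcases ht with rfl | rfl | rfl
  · exact ⟨by simp, by rwa [e0]⟩
  · exact ⟨by simp, by rwa [e1]⟩
  · exact ⟨by simp, by rwa [e2]⟩

/-- In the source's parameters (`E_λ = x³ + y³ + z³ + λxyz`, `λ = −3μ`): the dual member through
the nine inflection tangents of `E_λ` has parameter `λ' = −3ν = (54 − λ³)/(9λ)` — the value
`𝔠(λ)` of formula (cay) for the Cayleyan curve `Ca(E_λ)` (Prop. 3.3, NOT claimed here; consistent
with "the Cayleyan curve also parametrizes the line components of reducible polar conics", the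
inflection tangents being such components by §1). [cite: ArtebaniDolgachev2009, §3, formula (cay)] -/
theorem hesse_dual_inflectionTangent_parameter (h3 : (3 : K) ≠ 0) {μ la : K} (hμ : μ ≠ 0)
    (hla : la = -3 * μ) :
    -3 * ((μ ^ 3 + 2) / (3 * μ)) = (54 - la ^ 3) / (9 * la) := by
  subst hla
  have h9 : (9 : K) * (-3 * μ) ≠ 0 := by
    have : (9 : K) = 3 * 3 := by norm_num
    rw [this]
    exact mul_ne_zero (mul_ne_zero h3 h3) (mul_ne_zero (neg_ne_zero.2 h3) hμ)
  rw [show -3 * ((μ ^ 3 + 2) / (3 * μ)) = (-3 * (μ ^ 3 + 2)) / (3 * μ) by ring,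
    div_eq_div_iff (mul_ne_zero h3 hμ) h9]
  ring

end HarmonicPolars

end Literature.AlgebraicGeometry.PlaneCurves
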